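import Summits.NavierStokesRegularity.NavierStokesRegularity.Theses.TypeILiouville
import Summits.NavierStokesRegularity.NavierStokesRegularity.Theorems.TypeILiouvilleTypeIliouvilleNoTypeIIStubTimeDoubling
import Summits.NavierStokesRegularity.NavierStokesRegularity.Theorems.TypeILiouvilleTypeIliouvilleNoTypeIIStubSupNorm
import Summits.NavierStokesRegularity.NavierStokesRegularity.Theorems.TypeILiouvilleTypeIliouvilleNoTypeIIStubActiveWindows
import Summits.NavierStokesRegularity.NavierStokesRegularity.Theorems.TypeILiouvilleTypeIliouvilleNoTypeIIStubEternalLiouvilleOfL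
import HarnessLib

/-!
# `TypeIliouvilleNoTypeII` (stmt-NavierStokesRegularity-0056) from window activity and an eternal
# Liouville theorem — the composition of the line `Sketch` (immortal zoom), sorry-free

The crux `NoTypeII` (route `TypeILiouville`, rank 2; shared verbatim by 14 further routes): a
maximal smooth solution of Navier–Stokes on `ℝ³ × [0, T)` which is Leray–Hopf from a rapidly
decaying datum blows up at the Type I rate. This file proves it from TWO named hypotheses, every
other step being a theorem of the tree landed by the line:

* `hWA` — **window activity** ("no depleted Type-II blow-up"; the registered residual stub
  `stub_windowActivity`, OPEN, in its ∀∃ form): for `k ≥ k₀` and `t₂ ∈ [t₁, T)`, if some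
  sup-controlled two-sided window of parameter `k` is centred beyond `t₂` then some sup-controlled
  window of parameter `k` centred beyond `t₂` has an `ε`-active centre `ε M² ≤ ν‖∇u(t, x₀)‖`;
* `hEL` — an **eternal Liouville theorem** (the registered residual stub `stub_eternalLiouville`,
  OPEN): bounded eternal Oseen-mild smooth divergence-free fields on `ℝ × ℝ³` have zero gradient;
  it follows from KNSS's Liouville conjecture (L) = item `TypeIliouvilleL`
  (`stub_eternalLiouville_of_liouvilleConjecture`, landed), whence the second form
  `stub_noTypeII_of_windowActivity_of_L : WindowActivity → (L) → NoTypeII`.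

Proof (`typeIliouvilleNoTypeII_of_windowActivity_of_eternalLiouville`): if the blow-up is not Type I,
`‖u(t)‖_∞ √(T − t)` is unbounded (`unbounded_of_not_isTypeIBlowup`, with the sup-norm modulus of
`stub_supNorm`); the Poláčik–Quittner–Souplet time doubling (`stub_timeDoubling`) gives long
sup-controlled two-sided windows beyond every `t₂ < T` for every parameter; `hWA` turns them into
active windows, which feed the two-sided zoom (`stub_activeWindowsGenerateNonconstant`), whose limit
is a bounded eternal Oseen-mild smooth field with `‖∇v(0,0)‖ ≥ ε > 0`, contradicting `hEL`.
-/

noncomputable section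

-- the summit and its single problem share the name `NavierStokesRegularity` (D-0017 nested layout)
set_option linter.dupNamespace false

open Set Function Filter Topology MeasureTheory Metric
open scoped NNReal ENNReal

namespace Summit.NavierStokesRegularity.NavierStokesRegularity.Theorems.TypeIliouvilleNoTypeII.ImmortalZoom

open Literature.Analysis Literature.Analysis.FluidPDE

/-- `ℝ³`. -/
local notation "E3" => EuclideanSpace ℝ (Fin 3)

/-- Not Type I ⇒ any pointwise majorant `m` of the slices has `m(t) √(T - t)` unbounded as `t ↑ T`.
[folklore] -/
theorem unbounded_of_not_isTypeIBlowup {T : ℝ} {u : ℝ → E3 → E3} {m : ℝ → ℝ}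
    (hm : ∀ t ∈ Ico 0 T, ∀ x, ‖u t x‖ ≤ m t) (hT : 0 < T) (hII : ¬ IsTypeIBlowup u T) :
    ∀ K : ℝ, ∀ t₁ < T, ∃ t ∈ Ico 0 T, t₁ < t ∧ K < m t * Real.sqrt (T - t) := by
  intro K t₁ ht₁
  by_contra h
  push Not at h
  apply hII
  refine ⟨K, ?_⟩
  have hmem : Ioo (max t₁ 0) T ∈ 𝓝[<] T :=
    Ioo_mem_nhdsLT (max_lt ht₁ hT)
  filter_upwards [hmem] with t ht x
  have ht0 : 0 ≤ t := (le_max_right _ _).trans ht.1.le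
  have htT : t < T := ht.2
  have hK : m t * Real.sqrt (T - t) ≤ K := h t ⟨ht0, htT⟩ ((le_max_left _ _).trans_lt ht.1)
  have hs : 0 < Real.sqrt (T - t) := Real.sqrt_pos.2 (by linarith)
  rw [le_div_iff₀ hs]
  exact (mul_le_mul_of_nonneg_right (hm t ⟨ht0, htT⟩ x) hs.le).trans hK

/-- **`NoTypeII` from window activity and an eternal Liouville theorem** (the composition of the
line `Sketch`; see the module docstring). [cite: KochNadirashviliSereginSverak2009, §6 Prop. 6.1 and Lemma 6.1 (arXiv:0709.3599 p. 11)] -/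
theorem typeIliouvilleNoTypeII_of_windowActivity_of_eternalLiouville
    (hWA : ∀ (ν T : ℝ), 0 < ν → 0 < T → ∀ (u : ℝ → E3 → E3) (p : ℝ → E3 → ℝ),
      IsMaximalSmoothSolution ν 0 u p T → IsLerayHopfOn T ν 0 (u 0) u →
      HasRapidSpatialDecay (u 0) →
      ∃ ε k₀ t₁ : ℝ, 0 < ε ∧ t₁ < T ∧ ∀ k t₂ : ℝ, k₀ ≤ k → t₁ ≤ t₂ → t₂ < T →
        (∃ t M : ℝ, t₂ < t ∧ 0 < M ∧ Icc (t - k * ν / M ^ 2) (t + k * ν / M ^ 2) ⊆ Ioo 0 T ∧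
          (∀ s ∈ Icc (t - k * ν / M ^ 2) (t + k * ν / M ^ 2), ∀ x, ‖u s x‖ ≤ 2 * M) ∧
          ∃ x, M ≤ 2 * ‖u t x‖) →
        ∃ t M : ℝ, ∃ x₀ : E3, t₂ < t ∧ 0 < M ∧
          Icc (t - k * ν / M ^ 2) (t + k * ν / M ^ 2) ⊆ Ioo 0 T ∧
          (∀ s ∈ Icc (t - k * ν / M ^ 2) (t + k * ν / M ^ 2), ∀ x, ‖u s x‖ ≤ M) ∧
          ε * M ^ 2 ≤ ν * ‖fderiv ℝ (u t) x₀‖)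
    (hEL : ∀ v : ℝ → E3 → E3, ContDiff ℝ (⊤ : ℕ∞) (uncurry v) →
      (∀ t, VectorCalculus.IsDivFree (v t)) →
      (∀ s t : ℝ, s < t → ∀ x, v t x = heatFlow (v s) (t - s) x - oseenDuhamel 1 s v v t x) →
      (∃ C : ℝ, ∀ t x, ‖v t x‖ ≤ C) → ∀ t x, fderiv ℝ (v t) x = 0) :
    Summit.NavierStokesRegularity.NavierStokesRegularity.Theses.TypeILiouville.TypeIliouvilleNoTypeII := by
  intro ν T hν hT u p hmax hLH hdec
  by_contra hII
  -- the sup-norm modulus and the activity constants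
  obtain ⟨m, hmc, hle, hnear, c, hc, hler⟩ := stub_supNorm ν T hν hT u p hmax hLH hdec
  obtain ⟨ε, k₀, t₁, hε, ht₁, hact⟩ := hWA ν T hν hT u p hmax hLH hdec
  have hpos : ∀ t ∈ Ico 0 T, 0 < m t := fun t ht =>
    lt_of_lt_of_le (div_pos hc (Real.sqrt_pos.2 (by linarith [ht.2]))) (hler t ht)
  have hunb := unbounded_of_not_isTypeIBlowup hle hT hII
  -- active windows of every rescaled half-length `k`
  have hwin : ∀ k : ℕ, ∃ t M : ℝ, ∃ x₀ : E3, 0 < M ∧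
      Icc (t - k * ν / M ^ 2) (t + k * ν / M ^ 2) ⊆ Ioo 0 T ∧
      (∀ s ∈ Icc (t - k * ν / M ^ 2) (t + k * ν / M ^ 2), ∀ x, ‖u s x‖ ≤ M) ∧
      ε * M ^ 2 ≤ ν * ‖fderiv ℝ (u t) x₀‖ := by
    intro k
    -- a long doubling window with parameter `K = max k₀ k` beyond `t₂ = max t₁ 0`
    set K : ℝ := max (max k₀ k) 1 with hK
    have hK0 : 0 < K := lt_of_lt_of_le one_pos (le_max_right _ _)
    have hKν : 0 < Real.sqrt (K * ν) := Real.sqrt_pos.2 (mul_pos hK0 hν)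
    obtain ⟨t, ht, ht₁t, -, hleft, hright, hdoub⟩ :=
      stub_timeDoubling (k := Real.sqrt (K * ν)) hKν hmc hpos hunb (max t₁ 0) (max_lt ht₁ hT)
    have hMt : 0 < m t := hpos t ht
    have hsq : Real.sqrt (K * ν) ^ 2 = K * ν := Real.sq_sqrt (mul_pos hK0 hν).le
    rw [hsq] at hleft hright hdoub
    -- the doubling window is a sup-controlled window of parameter `K` and level `m t` beyond `t₂`
    have hsub : Icc (t - K * ν / m t ^ 2) (t + K * ν / m t ^ 2) ⊆ Ioo 0 T := fun s hs =>
      ⟨lt_of_lt_of_le hleft hs.1, lt_of_le_of_lt hs.2 hright⟩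
    have hbd : ∀ s ∈ Icc (t - K * ν / m t ^ 2) (t + K * ν / m t ^ 2), ∀ x, ‖u s x‖ ≤ 2 * m t := by
      intro s hs x
      have hsI : s ∈ Ico 0 T := ⟨(hsub hs).1.le, (hsub hs).2⟩
      exact (hle s hsI x).trans (hdoub s hs)
    have hnr : ∃ x, m t ≤ 2 * ‖u t x‖ := by
      obtain ⟨x, hx⟩ := hnear t ht (m t / 2) (by linarith)
      exact ⟨x, by linarith⟩
    obtain ⟨t', M, x₀, -, hM, hsub', hbd', hx₀⟩ := hact K (max t₁ 0)
      ((le_max_left _ _).trans (le_max_left _ _)) (le_max_left _ _) (max_lt ht₁ hT)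
      ⟨t, m t, ht₁t, hMt, hsub, hbd, hnr⟩
    -- shrink the active window from parameter `K` to parameter `k ≤ K`
    have hkK : (k : ℝ) * ν / M ^ 2 ≤ K * ν / M ^ 2 :=
      div_le_div_of_nonneg_right (mul_le_mul_of_nonneg_right
        ((le_max_right k₀ (k : ℝ)).trans (le_max_left _ 1)) hν.le) (by positivity)
    refine ⟨t', M, x₀, hM, fun r hr => hsub' ⟨?_, ?_⟩, fun r hr x => hbd' r ⟨?_, ?_⟩ x, hx₀⟩ <;>
      linarith [hr.1, hr.2]
  -- the eternal limit and the Liouville contradiction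
  obtain ⟨v, hv, hdiv, hmild, hbd, hgrad⟩ :=
    stub_activeWindowsGenerateNonconstant ν T hν hT u p hmax.1 hLH hdec ε hε hwin
  have h0 : fderiv ℝ (v 0) 0 = 0 := hEL v hv hdiv hmild ⟨1, hbd⟩ 0 0
  rw [h0, norm_zero] at hgrad
  linarith

/-- **`NoTypeII` from window activity and KNSS's Liouville conjecture (L)** (route
`TypeILiouville` carries (L) as its item `TypeIliouvilleL`; (L) ⇒ the eternal Liouville theorem is
the landed `stub_eternalLiouville_of_liouvilleConjecture`). Registered on the crux item as
`stub_noTypeII_of_windowActivity_of_L`: the crux is thereby closed MODULO the single residual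
`stub_windowActivity` for every route that carries (L). [cite: KochNadirashviliSereginSverak2009, §1 conjecture (L) and §6 Prop. 6.1 (arXiv:0709.3599)] -/
theorem stub_noTypeII_of_windowActivity_of_L
    (hWA : ∀ (ν T : ℝ), 0 < ν → 0 < T → ∀ (u : ℝ → E3 → E3) (p : ℝ → E3 → ℝ),
      IsMaximalSmoothSolution ν 0 u p T → IsLerayHopfOn T ν 0 (u 0) u →
      HasRapidSpatialDecay (u 0) →
      ∃ ε k₀ t₁ : ℝ, 0 < ε ∧ t₁ < T ∧ ∀ k t₂ : ℝ, k₀ ≤ k → t₁ ≤ t₂ → t₂ < T →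
        (∃ t M : ℝ, t₂ < t ∧ 0 < M ∧ Icc (t - k * ν / M ^ 2) (t + k * ν / M ^ 2) ⊆ Ioo 0 T ∧
          (∀ s ∈ Icc (t - k * ν / M ^ 2) (t + k * ν / M ^ 2), ∀ x, ‖u s x‖ ≤ 2 * M) ∧
          ∃ x, M ≤ 2 * ‖u t x‖) →
        ∃ t M : ℝ, ∃ x₀ : E3, t₂ < t ∧ 0 < M ∧
          Icc (t - k * ν / M ^ 2) (t + k * ν / M ^ 2) ⊆ Ioo 0 T ∧
          (∀ s ∈ Icc (t - k * ν / M ^ 2) (t + k * ν / M ^ 2), ∀ x, ‖u s x‖ ≤ M) ∧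
          ε * M ^ 2 ≤ ν * ‖fderiv ℝ (u t) x₀‖)
    (hL : Summit.NavierStokesRegularity.NavierStokesRegularity.Theses.TypeILiouville.TypeIliouvilleL) :
    Summit.NavierStokesRegularity.NavierStokesRegularity.Theses.TypeILiouville.TypeIliouvilleNoTypeII :=
  typeIliouvilleNoTypeII_of_windowActivity_of_eternalLiouville hWA
    (fun v hv hdiv hmild hbdd => stub_eternalLiouville_of_liouvilleConjecture hL v hv hdiv hmild hbdd)

end Summit.NavierStokesRegularity.NavierStokesRegularity.Theorems.TypeIliouvilleNoTypeII.ImmortalZoom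

end
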